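import Summits.BirchSwinnertonDyer.BirchSwinnertonDyer.Theorems.BiquadraticEisensteinDescentHeegnerTwistCouplingInSupplyQuarticCellPhiHat
import Literature.NumberTheory.EllipticCurves.HeathBrown1994.CongruentTwoSelmerMonskyFamilies
import HarnessLib

set_option linter.dupNamespace false -- `Summit.BirchSwinnertonDyer.BirchSwinnertonDyer.Theorems.…` (summit = sub)
set_option autoImplicit false

/-!
# Crux `HeegnerTwistCouplingInSupply` (stmt-BirchSwinnertonDyer-21381) — the `E_p` cell WITHOUT Monsky: plain `2`-isogeny descent of
# `E_n : y² = x³ − n² x`, `n = p·q·l`, `p ≡ 7 (mod 8)`, `q ≡ 3 (mod 8)` with `(q/p) = +1`, `l ≡ 5 (mod 8)` with `(l/p) = −1`: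
# `S(0, −n²) ⊆ {±1, ±n}` and `S(0, 4n²) ⊆ {1}` — UNCONDITIONAL (no named fact)

Route `BiquadraticEisensteinDescent` (cell `pub/bsd-wall`, width seat `bsd-wall-cm-bed-w3` g12; `--supports` 21381, helper). The corner theorems
of this layer for `W = E_p` (`…CornersThreeFacts.cruxOnEpCorner_of_three_facts`, lead `bsd-line-ibd-p1` g10/g11 and width seat w4 g12) certify
`L(E_{pql}, 1) ≠ 0` through Monsky's `2`-descent MATRIX theorem (a named fact, Heath-Brown 1994 appendix: `det = 1 ⟹ #Sel₂ = 4`) + Burungale–Tian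
+ Burungale–Flach. The cell of `…CornersThreeFacts.exists_cellData_p` — `n = p·q·l`, `p ≡ 7 (mod 8)`, `q ≡ 3 (mod 8)`, `(q/p) = +1`,
`l ≡ 5 (mod 8)`, `(l/p) = −1` — is in fact sharp for PLAIN `2`-ISOGENY descent, which the tree PROVES (Silverman AEC X.4.9:
`twoIsogenySelmerGroup 0 (−n²) = S^{(φ̂)}`, `twoIsogenySelmerGroup 0 (4n²) = twoIsogenySelmerGroup' 0 (−n²) = S^{(φ)}` for `(a, b) = (0, −n²)`):
PARI (kit j315629) finds `S(0,−n²) = {±1, ±n}`, `S(0, 4n²) = {1}` for 112/112 cell triples, i.e. `#S·#S′ = 4 = 2^{rank+2}·#Ш′[φ̂]·#Ш[φ]`.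
(The `E_{2p}` cell A is NOT sharp this way: `#S(0,−n²) = 16` there, 0/48 — Monsky's even matrix is a genuine full-`2`-descent statement.)
This file proves the two inclusions; the sequel `…CornersEpOneFact` turns them into `rank = 0`, `Ш[2] = 0`, `corank₂ = 0` and the corner
theorem modulo Burungale–Tian ONLY.

* §1 two more local lemmas for diagonal quartics `w² = d u⁴ + d′ z⁴` (`twoIsogenyQuartic 0 d d′`): `not_isSoluble_two_of_sq_eq_nine` — the
  ONE `2`-adic key `d² ≡ 9`, `d d′ ≡ −1 (mod 16)` (both charts `≡ 8 (mod 16)` or `≡ 3, 5 (mod 8)`; kills `±q, ±pq, ±l, ±pl` on the `φ̂`-side);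
  `not_isSoluble_padic_of_factorable` — `d = r d₁`, `d′ = −r d₁ c²`, `r ∤ d₁`, `±c` non-residues mod `r`: `w² = r d₁ (u² − c z²)(u² + c z²)`
  has no `ℚ_r`-point (kills `±ql` at `l`, `c = p`);
* §2 ★ `mem_twoIsogenySelmerGroup_neg_sq` — **`S(0, −n²) ⊆ {1, −1, n, −n}`**: `±p` die `l`-adically (`(p/l) = −1`, `l² ∥ d′` with
  `d′/l² = ∓p q²` a non-residue: `…QuarticLocal.not_isSoluble_padic_of_nonsquare_of_sq_mul`), `±ql` by the factorable lemma, the other eight by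
  the `2`-adic key (`p² ≡ 1`, `q² ≡ l² ≡ 9 (mod 16)`); ★ `mem_twoIsogenySelmerGroup_four_sq` — **`S(0, 4n²) ⊆ {1}`**: negatives die over `ℝ`,
  `p ∣ d` / `q ∣ d` by the reduced discriminant (`(−16m²/r) = (−1/r) = −1`, `…QuarticCellPhiHat.not_isSoluble_of_dvd_of_sq_dvd`), `2` at `q`
  (`(2/q) = −1`), `l` and `2l` at `p` (`(l/p) = (2l/p) = −1`).

HONEST FRAMING: unconditional arithmetic of one explicit family; nothing about `L`-values here; the crux (all CM `W` of analytic rank one;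
residual C⁺) and BSD are NOT proved by any of this. THEOREMS ONLY; supports stmt-BirchSwinnertonDyer-21381.
-/

noncomputable section

open scoped Classical

namespace Summit.BirchSwinnertonDyer.BirchSwinnertonDyer.Theorems.BiquadraticEisensteinDescentHeegnerTwistCouplingInSupplyEpCellTwoIsogeny

open _root_.WeierstrassCurve Literature.NumberTheory.EllipticCurves
open Literature.NumberTheory.EllipticCurves.HeathBrown1994.Families (jacobiSym_two_eq_neg_one jacobiSym_two_eq_one)
open Summit.BirchSwinnertonDyer.BirchSwinnertonDyer.Theorems.GoldfeldGoodTwists (not_isSoluble_two_of_zmodPow)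
open Summit.BirchSwinnertonDyer.BirchSwinnertonDyer.Theorems.BiquadraticEisensteinDescentHeegnerTwistCouplingInSupplyQuarticLocal
open Summit.BirchSwinnertonDyer.BirchSwinnertonDyer.Theorems.BiquadraticEisensteinDescentHeegnerTwistCouplingInSupplyQuarticCellPhiHat

/-! ## §1 Two local lemmas -/

section Local

/-- The `2`-adic key of the cell: for `d² ≡ 9` and `d d′ ≡ −1 (mod 16)` (so `d, d′ ≡ 3, 5 (mod 8)`, `d + d′ ≡ 8 (mod 16)`) both charts of
`w² = d u⁴ + d′ z⁴` are insoluble modulo `16`. [folklore] -/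
theorem zmod_key_sq_eq_nine :
    ∀ d e T S : ZMod (2 ^ 4), d ^ 2 = 9 → d * e = -1 → S ^ 2 ≠ d + 0 * T ^ 2 + e * T ^ 4 := by
  decide

/-- ★ **`d² ≡ 9`, `d·d′ ≡ −1 (mod 16)` ⇒ `w² = d u⁴ + d′ z⁴` has no `ℚ₂`-point.** [cite: SilvermanAEC2009, Prop. X.4.9] -/
theorem not_isSoluble_two_of_sq_eq_nine {d d' : ℤ} (hd : ((d : ℤ) : ZMod (2 ^ 4)) ^ 2 = 9)
    (hdd' : ((d : ℤ) : ZMod (2 ^ 4)) * d' = -1) :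
    ¬ ((twoIsogenyQuartic 0 d d').map (Int.castRingHom ℚ_[2])).IsSoluble := by
  have hd' : ((d' : ℤ) : ZMod (2 ^ 4)) ^ 2 = 9 := by
    have h81 : (((d : ℤ) : ZMod (2 ^ 4)) * d') ^ 2 = 1 := by rw [hdd']; ring
    rw [mul_pow, hd] at h81
    have key : ∀ x : ZMod (2 ^ 4), 9 * x = 1 → x = 9 := by decide
    exact key _ h81
  have hd'd : ((d' : ℤ) : ZMod (2 ^ 4)) * d = -1 := by rw [mul_comm]; exact hdd'
  refine not_isSoluble_two_of_zmodPow 4 4 (fun T S => ?_) (fun T S => ?_)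
  · have := zmod_key_sq_eq_nine _ _ T S hd hdd'
    push_cast
    convert this using 2
  · have := zmod_key_sq_eq_nine _ _ T S hd' hd'd
    push_cast
    convert this using 2

variable {r : ℕ} [hr : Fact r.Prime]

/-- ★ **The factorable kill**: `d = r d₁`, `d′ = −r d₁ c²` with `r ∤ d₁` and `±c` non-residues mod `r` ⇒ `w² = d u⁴ + d′ z⁴ = r d₁ (u² − c z²)(u² + c z²)`
has no `ℚ_r`-point: a `ℤ_r`-point in either chart forces `r ∣ d₁ (1 − c² t⁴)` resp. `r ∣ d₁ (t⁴ − c²)`, i.e. `c t² ≡ ±1` or `t² ≡ ±c`,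
making `c` or `−c` a square. (In the cell: the classes `±ql` of `S(0, −n²)` at `l`, `c = p`.) [cite: SilvermanAEC2009, Prop. X.4.9] -/
theorem not_isSoluble_padic_of_factorable {d d₁ d' c : ℤ} (hd : d = (r : ℤ) * d₁) (hd₁ : ¬ (r : ℤ) ∣ d₁) (hd' : d' = -((r : ℤ) * d₁ * c ^ 2))
    (hc : ¬ IsSquare ((c : ℤ) : ZMod r)) (hnc : ¬ IsSquare ((-c : ℤ) : ZMod r)) :
    ¬ ((twoIsogenyQuartic 0 d d').map (Int.castRingHom ℚ_[r])).IsSoluble := by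
  have hrr : Prime (r : ℤ_[r]) := PadicInt.prime_p
  have hd₁0 : ((d₁ : ℤ) : ZMod r) ≠ 0 := by rwa [Ne, ZMod.intCast_zmod_eq_zero_iff_dvd]
  -- from `d₁ · X = 0 (mod r)` with `X = 1 − c² t⁴` or `t⁴ − c²` to a square root of `±c`
  have finish : ∀ tt : ZMod r, ((c : ℤ) : ZMod r) ^ 2 * tt ^ 4 = 1 ∨ tt ^ 4 = ((c : ℤ) : ZMod r) ^ 2 → False := by
    intro tt h
    rcases h with h | h
    · have h1 : (((c : ℤ) : ZMod r) * tt ^ 2) ^ 2 = 1 := by rw [← h]; ring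
      have htt : tt ≠ 0 := by rintro rfl; simp at h
      rcases sq_eq_one_iff.mp h1 with h2 | h2
      · exact hc ⟨tt⁻¹, by field_simp; linear_combination h2⟩
      · exact hnc ⟨tt⁻¹, by push_cast; field_simp; linear_combination -h2⟩
    · have h1 : (tt ^ 2) ^ 2 = (((c : ℤ) : ZMod r)) ^ 2 := by rw [← h]; ring
      rcases sq_eq_sq_iff_eq_or_eq_neg.mp h1 with h2 | h2
      · exact hc ⟨tt, by rw [← sq, h2]⟩
      · exact hnc ⟨tt, by push_cast; rw [← sq, h2]⟩
  intro h
  rcases exists_padicInt_of_isSoluble_diagonal h with ⟨t, s, hs⟩ | ⟨t, s, hs⟩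
  · -- chart `u = 1`: `s² = r d₁ (1 − c² t⁴)`
    rw [hd, hd'] at hs
    push_cast at hs
    obtain ⟨s₁, rfl⟩ : (r : ℤ_[r]) ∣ s := hrr.dvd_of_dvd_pow ⟨(d₁ : ℤ_[r]) * (1 - c ^ 2 * t ^ 4), by rw [hs]; ring⟩
    have h1 : (d₁ : ℤ_[r]) * (1 - c ^ 2 * t ^ 4) = r * s₁ ^ 2 := mul_left_cancel₀ hrr.ne_zero (by linear_combination -hs)
    have h2 : ((d₁ : ℤ) : ZMod r) * (1 - ((c : ℤ) : ZMod r) ^ 2 * PadicInt.toZMod t ^ 4) = 0 := by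
      simpa using congrArg PadicInt.toZMod h1
    rcases mul_eq_zero.mp h2 with h3 | h3
    · exact hd₁0 h3
    · exact finish (PadicInt.toZMod t) (Or.inl (by linear_combination -h3))
  · -- chart `z = 1`: `s² = r d₁ (t⁴ − c²)`
    rw [hd, hd'] at hs
    push_cast at hs
    obtain ⟨s₁, rfl⟩ : (r : ℤ_[r]) ∣ s := hrr.dvd_of_dvd_pow ⟨(d₁ : ℤ_[r]) * (t ^ 4 - c ^ 2), by rw [hs]; ring⟩
    have h1 : (d₁ : ℤ_[r]) * (t ^ 4 - c ^ 2) = r * s₁ ^ 2 := mul_left_cancel₀ hrr.ne_zero (by linear_combination -hs)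
    have h2 : ((d₁ : ℤ) : ZMod r) * (PadicInt.toZMod t ^ 4 - ((c : ℤ) : ZMod r) ^ 2) = 0 := by
      simpa using congrArg PadicInt.toZMod h1
    rcases mul_eq_zero.mp h2 with h3 | h3
    · exact hd₁0 h3
    · exact finish (PadicInt.toZMod t) (Or.inr (by linear_combination h3))

end Local

/-! ## §2 The two Selmer sets of `E_n`, `n = p q l` in the cell -/

section Selmer

variable {p q l : ℕ}

/-- Residues modulo `16`: `p² ≡ 1`, `q² ≡ 9`, `l² ≡ 9` for `p ≡ 7`, `q ≡ 3`, `l ≡ 5 (mod 8)`. [folklore] -/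
theorem sq_cast_zmod16 (hp8 : p % 8 = 7) (hq8 : q % 8 = 3) (hl8 : l % 8 = 5) :
    (p : ZMod (2 ^ 4)) ^ 2 = 1 ∧ (q : ZMod (2 ^ 4)) ^ 2 = 9 ∧ (l : ZMod (2 ^ 4)) ^ 2 = 9 := by
  refine ⟨?_, ?_, ?_⟩
  · rw [← ZMod.natCast_mod p (2 ^ 4)]
    rcases (show p % 2 ^ 4 = 7 ∨ p % 2 ^ 4 = 15 by omega) with h | h <;> rw [h] <;> decide
  · rw [← ZMod.natCast_mod q (2 ^ 4)]
    rcases (show q % 2 ^ 4 = 3 ∨ q % 2 ^ 4 = 11 by omega) with h | h <;> rw [h] <;> decide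
  · rw [← ZMod.natCast_mod l (2 ^ 4)]
    rcases (show l % 2 ^ 4 = 5 ∨ l % 2 ^ 4 = 13 by omega) with h | h <;> rw [h] <;> decide

/-- Square-free divisors of a square `N²` divide `N`. [folklore] -/
theorem natAbs_dvd_of_squarefree_of_dvd_sq {d : ℤ} {N : ℕ} (hsq : Squarefree d) (hdb : d ∣ (N : ℤ) ^ 2) : d.natAbs ∣ N := by
  have h1 : d.natAbs ∣ N ^ 2 := by simpa [Int.natAbs_pow] using Int.natAbs_dvd_natAbs.mpr hdb
  exact (Squarefree.dvd_pow_iff_dvd (Int.squarefree_natAbs.mpr hsq) two_ne_zero).mp h1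

/-- Divisors of `p q l` (primes): the eight products. [folklore] -/
theorem eq_of_dvd_three_primes {m : ℕ} (hp : p.Prime) (hq : q.Prime) (hl : l.Prime) (h : m ∣ p * q * l) :
    m = 1 ∨ m = p ∨ m = q ∨ m = l ∨ m = p * q ∨ m = p * l ∨ m = q * l ∨ m = p * q * l := by
  obtain ⟨a, b, ha, hb, rfl⟩ := Nat.dvd_mul.mp h
  obtain ⟨a₁, a₂, ha₁, ha₂, rfl⟩ := Nat.dvd_mul.mp ha
  rcases (Nat.dvd_prime hp).mp ha₁ with rfl | rfl <;> rcases (Nat.dvd_prime hq).mp ha₂ with rfl | rfl <;>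
    rcases (Nat.dvd_prime hl).mp hb with rfl | rfl <;> simp [mul_comm]

/-- Divisors of `2 l` (`l` prime): `1, 2, l, 2l`. [folklore] -/
theorem eq_of_dvd_two_mul_prime {m : ℕ} (hl : l.Prime) (h : m ∣ 2 * l) : m = 1 ∨ m = 2 ∨ m = l ∨ m = 2 * l := by
  obtain ⟨a, b, ha, hb, rfl⟩ := Nat.dvd_mul.mp h
  rcases (Nat.dvd_prime Nat.prime_two).mp ha with rfl | rfl <;> rcases (Nat.dvd_prime hl).mp hb with rfl | rfl <;> simp

/-- ★ **`S(0, −n²) ⊆ {1, −1, n, −n}`** for `E_n : y² = x³ − n² x`, `n = p q l` in the cell (`p ≡ 7 (mod 8)`, `q ≡ 3 (mod 8)`, `(q/p) = +1`,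
`l ≡ 5 (mod 8)`, `(l/p) = −1`): the descent-on-divisors-of-`b` Selmer set contains only the images of the `2`-torsion. [cite: SilvermanAEC2009, Prop. X.4.9] -/
theorem mem_twoIsogenySelmerGroup_neg_sq (hp : p.Prime) (hq : q.Prime) (hl : l.Prime) (hp8 : p % 8 = 7) (hq8 : q % 8 = 3) (hl8 : l % 8 = 5)
    (hJq : jacobiSym (q : ℤ) p = 1) (hJl : jacobiSym (l : ℤ) p = -1) {d : ℤ}
    (h : d ∈ twoIsogenySelmerGroup 0 (-(((p * q * l : ℕ) : ℤ) ^ 2))) :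
    d = 1 ∨ d = -1 ∨ d = ((p * q * l : ℕ) : ℤ) ∨ d = -((p * q * l : ℕ) : ℤ) := by
  haveI : Fact (Nat.Prime 2) := ⟨Nat.prime_two⟩
  haveI : Fact l.Prime := ⟨hl⟩
  have hqp : q ≠ p := q_ne_p hq hJq
  have hlp : l ≠ p := l_ne_p hl hJl
  have hql : q ≠ l := by omega
  have hn0 : ((p * q * l : ℕ) : ℤ) ≠ 0 := by exact_mod_cast Nat.mul_ne_zero (Nat.mul_ne_zero hp.ne_zero hq.ne_zero) hl.ne_zero
  have hb : -(((p * q * l : ℕ) : ℤ) ^ 2) ≠ 0 := neg_ne_zero.mpr (pow_ne_zero 2 hn0)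
  obtain ⟨hsq, hdvd, hloc⟩ := (mem_twoIsogenySelmerGroup_iff hb).mp h
  have hJpl : jacobiSym (p : ℤ) l = -1 := by
    rw [← jacobiSym.quadratic_reciprocity_one_mod_four (by omega) (Nat.odd_iff.mpr (by omega)), hJl]
  have hlodd : Odd l := Nat.odd_iff.mpr (by omega)
  have hJm1l : jacobiSym (-1 : ℤ) l = 1 := by rw [jacobiSym.at_neg_one hlodd, ZMod.χ₄_nat_one_mod_four (by omega)]
  have hJmpl : jacobiSym (-(p : ℤ)) l = -1 := by rw [show (-(p : ℤ)) = (-1) * p by ring, jacobiSym.mul_left, hJm1l, hJpl]; norm_num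
  have hgq_l : ((q : ℕ) : ℤ).gcd l = 1 := by rw [Int.gcd_natCast_natCast]; exact (Nat.coprime_primes hq hl).mpr hql
  have hJq2l : jacobiSym (((q : ℕ) : ℤ) ^ 2) l = 1 := jacobiSym.sq_one' hgq_l
  have hnr_l : ∀ x : ℤ, jacobiSym x l = -1 → ¬ IsSquare ((x : ℤ) : ZMod l) := fun x hx => ZMod.nonsquare_of_jacobiSym_eq_neg_one hx
  obtain ⟨hp2, hq9, hl9⟩ := sq_cast_zmod16 hp8 hq8 hl8
  have hp0 : (p : ℤ) ≠ 0 := by exact_mod_cast hp.ne_zero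
  have hql0 : (q : ℤ) * l ≠ 0 := by exact_mod_cast Nat.mul_ne_zero hq.ne_zero hl.ne_zero
  have hlq : ¬ (l : ℤ) ∣ q := fun h' => hql ((Nat.prime_dvd_prime_iff_eq hl hq).mp (Int.natCast_dvd_natCast.mp h')).symm
  -- the `2`-adic kill from `d² ≡ 9 (mod 16)`: then `d · (B/d) = −n² ≡ −81 ≡ −1`
  have two_kill : ((d : ℤ) : ZMod (2 ^ 4)) ^ 2 = 9 → False := by
    intro hd9
    refine not_isSoluble_two_of_sq_eq_nine hd9 ?_ (hloc.2 2)
    have hmul : d * (-(((p * q * l : ℕ) : ℤ) ^ 2) / d) = -(((p * q * l : ℕ) : ℤ) ^ 2) := Int.mul_ediv_cancel' hdvd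
    have := congrArg (fun z : ℤ => ((z : ℤ) : ZMod (2 ^ 4))) hmul
    push_cast at this ⊢
    rw [this, show ((p : ZMod (2 ^ 4)) * q * l) ^ 2 = (p : ZMod (2 ^ 4)) ^ 2 * (q : ZMod (2 ^ 4)) ^ 2 * (l : ZMod (2 ^ 4)) ^ 2 by ring,
      hp2, hq9, hl9]
    decide
  -- the square-free part: `|d| ∣ pql`
  have habs := eq_of_dvd_three_primes hp hq hl (natAbs_dvd_of_squarefree_of_dvd_sq hsq (by simpa using hdvd))
  rcases habs with c1 | c2 | c3 | c4 | c5 | c6 | c7 | c8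
  · rcases Int.natAbs_eq d with h | h
    · left; omega
    · right; left; omega
  · -- `d = p`, `d = −p`: die at `l` (`(±p/l) = −1`, `B/d = l²·(∓p q²)` with `(∓p q²/l) = −1`)
    exfalso
    have h2 := hloc.2 l
    rcases Int.natAbs_eq d with h | h <;> rw [c2] at h <;> subst h
    · have hdiv : -(((p * q * l : ℕ) : ℤ) ^ 2) / (p : ℤ) = (l : ℤ) ^ 2 * (-(p : ℤ) * q ^ 2) :=
        Int.ediv_eq_of_eq_mul_right hp0 (by push_cast; ring)
      rw [hdiv] at h2
      refine not_isSoluble_padic_of_nonsquare_of_sq_mul rfl (hnr_l p hJpl) (hnr_l _ ?_) h2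
      rw [jacobiSym.mul_left, hJmpl, hJq2l]; norm_num
    · have hdiv : -(((p * q * l : ℕ) : ℤ) ^ 2) / (-(p : ℤ)) = (l : ℤ) ^ 2 * ((p : ℤ) * q ^ 2) :=
        Int.ediv_eq_of_eq_mul_right (neg_ne_zero.mpr hp0) (by push_cast; ring)
      rw [hdiv] at h2
      refine not_isSoluble_padic_of_nonsquare_of_sq_mul rfl (hnr_l _ hJmpl) (hnr_l _ ?_) h2
      rw [jacobiSym.mul_left, hJpl, hJq2l]; norm_num
  · -- `d = ±q`: `2`-adically
    refine (two_kill ?_).elim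
    rcases Int.natAbs_eq d with h | h <;> rw [c3] at h <;> rw [h] <;> push_cast
    · exact hq9
    · rw [neg_sq]; exact hq9
  · -- `d = ±l`: `2`-adically
    refine (two_kill ?_).elim
    rcases Int.natAbs_eq d with h | h <;> rw [c4] at h <;> rw [h] <;> push_cast
    · exact hl9
    · rw [neg_sq]; exact hl9
  · -- `d = ±pq`: `2`-adically
    refine (two_kill ?_).elim
    rcases Int.natAbs_eq d with h | h <;> rw [c5] at h <;> rw [h] <;> push_cast
    · rw [mul_pow, hp2, hq9]; norm_num
    · rw [neg_sq, mul_pow, hp2, hq9]; norm_num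
  · -- `d = ±pl`: `2`-adically
    refine (two_kill ?_).elim
    rcases Int.natAbs_eq d with h | h <;> rw [c6] at h <;> rw [h] <;> push_cast
    · rw [mul_pow, hp2, hl9]; norm_num
    · rw [neg_sq, mul_pow, hp2, hl9]; norm_num
  · -- `d = ±ql`: the factorable kill at `l` (`B/d = −d·p²`, `(±p/l) = −1`)
    exfalso
    have h2 := hloc.2 l
    rcases Int.natAbs_eq d with h | h <;> rw [c7] at h <;> subst h
    · have hdiv : -(((p * q * l : ℕ) : ℤ) ^ 2) / ((q * l : ℕ) : ℤ) = -((l : ℤ) * q * (p : ℤ) ^ 2) :=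
        Int.ediv_eq_of_eq_mul_right (by exact_mod_cast Nat.mul_ne_zero hq.ne_zero hl.ne_zero) (by push_cast; ring)
      rw [hdiv] at h2
      exact not_isSoluble_padic_of_factorable (d₁ := (q : ℤ)) (c := (p : ℤ)) (by push_cast; ring) hlq rfl (hnr_l p hJpl) (hnr_l _ hJmpl) h2
    · have hdiv : -(((p * q * l : ℕ) : ℤ) ^ 2) / (-((q * l : ℕ) : ℤ)) = -((l : ℤ) * (-(q : ℤ)) * (p : ℤ) ^ 2) :=
        Int.ediv_eq_of_eq_mul_right (neg_ne_zero.mpr (by exact_mod_cast Nat.mul_ne_zero hq.ne_zero hl.ne_zero)) (by push_cast; ring)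
      rw [hdiv] at h2
      exact not_isSoluble_padic_of_factorable (d₁ := -(q : ℤ)) (c := (p : ℤ)) (by push_cast; ring) (fun h' => hlq ((dvd_neg).mp h')) rfl
        (hnr_l p hJpl) (hnr_l _ hJmpl) h2
  · rcases Int.natAbs_eq d with h | h <;> rw [c8] at h
    · exact Or.inr (Or.inr (Or.inl h))
    · exact Or.inr (Or.inr (Or.inr h))

/-- ★ **`S(0, 4n²) ⊆ {1}`** for `E_n`, `n = p q l` in the cell — the descent on the divisors of `a² − 4b = 4n²` (`S^{(φ)}(E_n/ℚ)`): negatives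
die over `ℝ`, `p ∣ d` and `q ∣ d` by the reduced discriminant (`(−1/p) = (−1/q) = −1`), `2` at `q` (`(2/q) = −1`), `l` and `2l` at `p`
(`(l/p) = (2l/p) = −1`). [cite: SilvermanAEC2009, Prop. X.4.9] -/
theorem mem_twoIsogenySelmerGroup_four_sq (hp : p.Prime) (hq : q.Prime) (hl : l.Prime) (hp8 : p % 8 = 7) (hq8 : q % 8 = 3) (hl8 : l % 8 = 5)
    (hJq : jacobiSym (q : ℤ) p = 1) (hJl : jacobiSym (l : ℤ) p = -1) {d : ℤ}
    (h : d ∈ twoIsogenySelmerGroup 0 (4 * ((p * q * l : ℕ) : ℤ) ^ 2)) : d = 1 := by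
  haveI : Fact p.Prime := ⟨hp⟩
  haveI : Fact q.Prime := ⟨hq⟩
  have hqp : q ≠ p := q_ne_p hq hJq
  have hlp : l ≠ p := l_ne_p hl hJl
  have hql : q ≠ l := by omega
  have hb : 4 * ((p * q * l : ℕ) : ℤ) ^ 2 ≠ 0 := by
    have : ((p * q * l : ℕ) : ℤ) ≠ 0 := by exact_mod_cast Nat.mul_ne_zero (Nat.mul_ne_zero hp.ne_zero hq.ne_zero) hl.ne_zero
    positivity
  obtain ⟨hsq, hdvd, hloc⟩ := (mem_twoIsogenySelmerGroup_iff hb).mp h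
  have hp0 : (p : ℤ) ≠ 0 := by exact_mod_cast hp.ne_zero
  have hnr_p : ∀ x : ℤ, jacobiSym x p = -1 → ¬ IsSquare ((x : ℤ) : ZMod p) := fun x hx => ZMod.nonsquare_of_jacobiSym_eq_neg_one hx
  have hnr_q : ∀ x : ℤ, jacobiSym x q = -1 → ¬ IsSquare ((x : ℤ) : ZMod q) := fun x hx => ZMod.nonsquare_of_jacobiSym_eq_neg_one hx
  have hJ2q : jacobiSym (2 : ℤ) q = -1 := jacobiSym_two_eq_neg_one (Or.inl hq8)
  have hJ2p : jacobiSym (2 : ℤ) p = 1 := jacobiSym_two_eq_one (Or.inr hp8)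
  have hgpl_q : ((p * l : ℕ) : ℤ).gcd q = 1 := by
    rw [Int.gcd_natCast_natCast]; exact Nat.Coprime.mul_left ((Nat.coprime_primes hp hq).mpr hqp.symm) ((Nat.coprime_primes hl hq).mpr hql.symm)
  have hgq_p : ((q : ℕ) : ℤ).gcd p = 1 := by rw [Int.gcd_natCast_natCast]; exact (Nat.coprime_primes hq hp).mpr hqp
  have hg2q_p : ((2 * q : ℕ) : ℤ).gcd p = 1 := by
    rw [Int.gcd_natCast_natCast]; exact Nat.Coprime.mul_left ((Nat.coprime_primes Nat.prime_two hp).mpr (by omega)) ((Nat.coprime_primes hq hp).mpr hqp)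
  -- `d > 0`
  have hd0 : 0 < d := by
    by_contra hle
    have hd0 : d < 0 := lt_of_le_of_ne (not_lt.mp hle) hsq.ne_zero
    have hmul : d * (4 * ((p * q * l : ℕ) : ℤ) ^ 2 / d) = 4 * ((p * q * l : ℕ) : ℤ) ^ 2 := Int.mul_ediv_cancel' hdvd
    have hd'0 : 4 * ((p * q * l : ℕ) : ℤ) ^ 2 / d < 0 := by
      by_contra hge
      push Not at hge
      have hpos : (0 : ℤ) < 4 * ((p * q * l : ℕ) : ℤ) ^ 2 := by positivity
      nlinarith [mul_nonneg (neg_pos.mpr hd0).le hge]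
    exact not_isSoluble_real_twoIsogenyQuartic_of_neg hd0 hd'0 le_rfl hloc.1
  -- `p ∤ d`, `q ∤ d`: reduced discriminant `−16 m²`, a non-residue at a prime `≡ 3 (mod 4)`
  have hkill : ∀ (r m : ℕ), r.Prime → r % 4 = 3 → p * q * l = r * m → Nat.Coprime m r → ¬ (r : ℤ) ∣ d := by
    intro r m hr hr4 hm hmr hrd
    haveI : Fact r.Prime := ⟨hr⟩
    have hg : ((4 * m : ℕ) : ℤ).gcd r = 1 := by
      rw [Int.gcd_natCast_natCast, show (4 : ℕ) = 2 ^ 2 by norm_num]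
      exact Nat.Coprime.mul_left (Nat.Coprime.pow_left 2 ((Nat.coprime_primes Nat.prime_two hr).mpr (by omega))) hmr
    refine not_isSoluble_of_dvd_of_sq_dvd (r := r) (c := 4 * (m : ℤ) ^ 2) (by rw [hm]; push_cast; ring) hsq hrd hdvd ?_ (hloc.2 r)
    rw [show (-4 * (4 * (m : ℤ) ^ 2) : ℤ) = (-1) * ((4 * m : ℕ) : ℤ) ^ 2 by push_cast; ring, jacobiSym.mul_left,
      jacobiSym.at_neg_one (Nat.odd_iff.mpr (by omega)), ZMod.χ₄_nat_three_mod_four hr4, jacobiSym.sq_one' hg]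
    norm_num
  have hpd : ¬ (p : ℤ) ∣ d := hkill p (q * l) hp (by omega) (by ring)
    (Nat.Coprime.mul_left ((Nat.coprime_primes hq hp).mpr hqp) ((Nat.coprime_primes hl hp).mpr hlp))
  have hqd : ¬ (q : ℤ) ∣ d := hkill q (p * l) hq (by omega) (by ring)
    (Nat.Coprime.mul_left ((Nat.coprime_primes hp hq).mpr hqp.symm) ((Nat.coprime_primes hl hq).mpr hql.symm))
  -- the square-free part: `d ∣ 2l`
  obtain ⟨n, rfl⟩ := Int.eq_ofNat_of_zero_le hd0.le
  have hnsq : Squarefree n := Int.squarefree_natCast.mp hsq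
  have hn1 : n ∣ (2 * (p * q * l)) ^ 2 := by
    have : (n : ℤ) ∣ (((2 * (p * q * l) : ℕ) : ℤ)) ^ 2 := by
      rw [show (((2 * (p * q * l) : ℕ) : ℤ)) ^ 2 = 4 * ((p * q * l : ℕ) : ℤ) ^ 2 by push_cast; ring]; exact hdvd
    exact_mod_cast this
  have hn2 : n ∣ 2 * (p * q * l) := (Squarefree.dvd_pow_iff_dvd hnsq two_ne_zero).mp hn1
  have hnp : Nat.Coprime n p := Nat.coprime_comm.mp ((Nat.Prime.coprime_iff_not_dvd hp).mpr fun h' => hpd (Int.natCast_dvd_natCast.mpr h'))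
  have hnq : Nat.Coprime n q := Nat.coprime_comm.mp ((Nat.Prime.coprime_iff_not_dvd hq).mpr fun h' => hqd (Int.natCast_dvd_natCast.mpr h'))
  have hn3 : n ∣ 2 * l := by
    have : n ∣ (2 * l) * (p * q) := by rw [show (2 * l) * (p * q) = 2 * (p * q * l) by ring]; exact hn2
    exact (Nat.Coprime.mul_right hnp hnq).dvd_of_dvd_mul_right this
  rcases eq_of_dvd_two_mul_prime hl hn3 with h | h | h | h
  · rw [h]; simp
  · -- `d = 2`: dies at `q` (`(2/q) = −1`, `4n²/2 = q²·(2 p² l²)`)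
    exfalso
    rw [h] at hloc
    have hdiv : 4 * ((p * q * l : ℕ) : ℤ) ^ 2 / ((2 : ℕ) : ℤ) = (q : ℤ) ^ 2 * (2 * ((p * l : ℕ) : ℤ) ^ 2) :=
      Int.ediv_eq_of_eq_mul_right (by norm_num) (by push_cast; ring)
    have h2 := hloc.2 q
    rw [hdiv] at h2
    refine not_isSoluble_padic_of_nonsquare_of_sq_mul rfl (hnr_q _ (by exact_mod_cast hJ2q)) (hnr_q _ ?_) h2
    rw [jacobiSym.mul_left, hJ2q, jacobiSym.sq_one' hgpl_q]; norm_num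
  · -- `d = l`: dies at `p` (`(l/p) = −1`, `4n²/l = p²·(4 q² l)`)
    exfalso
    rw [h] at hloc
    have hdiv : 4 * ((p * q * l : ℕ) : ℤ) ^ 2 / ((l : ℕ) : ℤ) = (p : ℤ) ^ 2 * (((2 * q : ℕ) : ℤ) ^ 2 * l) :=
      Int.ediv_eq_of_eq_mul_right (by exact_mod_cast hl.ne_zero) (by push_cast; ring)
    have h2 := hloc.2 p
    rw [hdiv] at h2
    refine not_isSoluble_padic_of_nonsquare_of_sq_mul rfl (hnr_p _ hJl) (hnr_p _ ?_) h2
    rw [jacobiSym.mul_left, jacobiSym.sq_one' hg2q_p, hJl]; norm_num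
  · -- `d = 2l`: dies at `p` (`(2l/p) = −1`, `4n²/(2l) = p²·(2 q² l)`)
    exfalso
    rw [h] at hloc
    have hdiv : 4 * ((p * q * l : ℕ) : ℤ) ^ 2 / ((2 * l : ℕ) : ℤ) = (p : ℤ) ^ 2 * (2 * ((q : ℕ) : ℤ) ^ 2 * l) :=
      Int.ediv_eq_of_eq_mul_right (by exact_mod_cast Nat.mul_ne_zero two_ne_zero hl.ne_zero) (by push_cast; ring)
    have h2 := hloc.2 p
    rw [hdiv] at h2
    refine not_isSoluble_padic_of_nonsquare_of_sq_mul rfl (hnr_p _ ?_) (hnr_p _ ?_) h2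
    · rw [show (((2 * l : ℕ) : ℤ)) = 2 * (l : ℤ) by push_cast; ring, jacobiSym.mul_left, hJ2p, hJl]; norm_num
    · rw [jacobiSym.mul_left, jacobiSym.mul_left, hJ2p, jacobiSym.sq_one' hgq_p, hJl]; norm_num

end Selmer

end Summit.BirchSwinnertonDyer.BirchSwinnertonDyer.Theorems.BiquadraticEisensteinDescentHeegnerTwistCouplingInSupplyEpCellTwoIsogeny

end
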